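import Summits.AtomisticToContinuum.BoseEinsteinCondensation.Theses.BECInsertionVariance
import Literature.MathematicalPhysics.QuantumManyBody.SwapEntropy

/-!
# Line `twosided` — alternative skeleton for the crux `BECInsertionVariance.EntropyFromStructure`
(crux item stmt-AtomisticToContinuum-12064, rank 2 of route `route-AtomisticToContinuum-BECInsertionVariance`;
registered by the crux strategist planner-cstrat-stmt-AtomisticToContinuum-12064-s1-0, 2026-08-17; it does NOT
replace the live line `Lines/birth.lean` — it is an ALTERNATIVE cut of the same crux, sharing birth's exact stub S1).

Crux (FIXED, by name): `EntropyFromStructure` — for `v`, `0 < ρ < ρ₀(v)` and ANY `C_H, C_L` there is `C` with, for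
all large `N = n+1` and `Ψ₀ = groundState v N (N/ρ)^{1/3}`: [H: `C_H`-hyperuniform on the window] → [L: one-body
log-Harnack at scale `(ρa)^{-1/2}` with constant `C_L`] → [accessible swap mass ≥ 1/2] → accessible swap entropy ≤ `C`.

THE CUT ("two-sided information split"). With `p_X̂ = Ψ₀(·,X̂)²/Z(X̂)`, `Z(X̂) = ∫Ψ₀(z,X̂)² dz`, `n` the one-body
law and `u_Λ` the uniform law on the box, the one-copy teleportation log-ratio is centred at the BOX AVERAGE
`c(X̂) = log(L⁻³ Z(X̂))` instead of being coarse-grained at the healing scale (birth):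
  `log Ψ₀²(x₀,X̂) − log Ψ₀²(y₀,X̂) = [log Ψ₀²(x₀,X̂) − c(X̂)] + [c(X̂) − log Ψ₀²(y₀,X̂)] = log(L³p_X̂(x₀)) − log(L³p_X̂(y₀))`.
Behind it is the exact identity (soft `v`, full supports) `KL(p‖q) = 2·E_X̂[KL(p_X̂‖n) + KL(n‖p_X̂)] = 2[I(x₀;X̂) + L(x₀;X̂)]`
(mutual + lautum information of one boson versus the rest under `Ψ₀²`), and `KL ≤ D_acc ≤ KL + 1`.
* T1 `stub_oneCopyReduction` (general `Φ`, exact; = birth's S1 verbatim): swap entropy ≤ 2 × one-copy entropy.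
* T2 `stub_boxAverageSplit` (general `Φ`, ANY reference volume `κ`, exact): one-copy accessible entropy
  ≤ T_conc(Φ,κ) + T_hole(Φ,κ), from `(a−b)⁺ ≤ (a−c)⁺ + (c−b)⁺` pointwise with `c = log((∫Φ(·,X̂)²)/κ)` (any junk value
  of `c` is a real number, so no positivity of `κ` is needed), `ofReal` subadditivity, `lintegral_add_left`
  (measurability of the parametric integral `Measurable.lintegral_prod_right'`) and `Measure.restrict_le_self`.
* T3 `stub_concentrationSide` (THE GROUND STATE, κ = L³, NO structural hypothesis): `T_conc(Ψ₀) ≤ C`, i.e.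
  `E_X̂ E_{x₀∼p_X̂}[(log L³p_X̂(x₀))⁺] ≤ C` — "at the boson's ACTUAL position the conditional density does not exceed
  the uniform density by much, in log-mean" (no localised vacancy / no Bragg order). Since
  `E[(log L³p)⁺] ≤ KL(p_X̂‖u_Λ) + e⁻¹` and `E_X̂ KL(p_X̂‖u_Λ) = I(x₀;X̂) + KL(n‖u_Λ)`, T3 is the exact-ground-state
  specialisation of the TARGET `CondEntropyBound` (stmt-AtomisticToContinuum-13438) of the sibling route
  `BECCellInformation` — whose two-scale reduction `TwoScaleReduction` (13443) and `CoarseChainRule` (13441) are PROVED,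
  leaving `CellInformationBound` (13439, coarse mutual information) + `OneBodyEntropyBound` (13440, profile) — and it is
  also implied by `BECDeletionChiSquare.ChiSquareTolerance` (11937) via `KL ≤ log(1+χ²) ≤ log m₂` (plus the compactness
  passage near-minimisers → `groundState`, lower semicontinuity of KL under L¹ convergence of densities).
* T4 `stub_holeSide` (THE GROUND STATE, κ = L³, crux hypotheses H, L and mass kept VERBATIM): `T_hole(Ψ₀) ≤ C`, i.e.
  `E_X̂ E_{y∼n}[(−log L³p_X̂(y))⁺ ; Ψ₀(y,X̂) ≠ 0] ≤ C` — "at an INDEPENDENT accessible point the conditional density is not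
  far BELOW uniform, in log-mean" (lautum side / anti-concentration: no deep holes beyond hard cores and healing layers).
  This half has no sibling in the sub-problem; it contains birth's tilt (S4) and the infrared at uniform points. L is
  load-bearing at least to exclude the super-singular soft cores (`v = r^{-p}`, `p ≥ 8`, crux-attack evidence on 12064:
  `T_hole = +∞` there, and L(b) fails there, so the stub is vacuous exactly where it must be).
* `EntropyFromStructure_of : EntropyFromStructure` — kernel-checked glue: `ρ₀ = min ρ₃ ρ₄`, `C = 2(C₃⁺ + C₄⁺)`,
  `filter_upwards`, T1 at `Φ := Ψ₀`, T2 at `κ := L³`, then T3 and T4.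
Honest loss versus the crux: the box-average split forgoes the exact cancellation of one-body (wall) profiles inside
`log p − log q`; the wall layer then costs `O((ξ/L) log(L/ξ)) → 0` on each side separately (n-mass `O(ξ/L)` of the layer
× log-singularity `2 log(ξ/d)` integrable against `n ∝ d²`).
Disproof used: none on file for this crux (`ledger crux ls`: no Disproof.lean; negatives index: no entry for R).
Sorries: exactly the four `stub_*`; nothing else.
-/

namespace Summit.AtomisticToContinuum.BoseEinsteinCondensation.Cruxes.EntropyFromStructure.TwoSided

open Summit.AtomisticToContinuum.BoseEinsteinCondensation.Theses.BECInsertionVariance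
open MeasureTheory Filter

/-- stub T1 — ONE-COPY REDUCTION (= birth's S1 `stub_swapSymmetrisation`, verbatim signature; general measurable
real `Φ`, exact, size M). On `{q ≠ 0}` the swap log-ratio is the sum of the two one-copy log-ratios, exchanged by
the measure-preserving replica flip `(X,Y) ↦ (Y,X)` which fixes `p` and `{q ≠ 0}`; `ofReal` is subadditive and
`{q ≠ 0} ⊆ {Φ(X[0↦y₀]) ≠ 0}`: accessible swap entropy ≤ 2 · one-copy teleportation entropy. Tools:
`lintegral_comp_replicaSwap`, `Real.log_mul`, `ENNReal.ofReal_add_le`, `lintegral_mono_set` (SwapEntropy.lean).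
Shared with line `birth`: one proof closes the stub for both lines. -/
theorem stub_oneCopyReduction :
    ∀ (n : ℕ) (Φ : Literature.MathematicalPhysics.QuantumManyBody.BoseGas.Config (n + 1) → ℝ), Measurable Φ → (∫⁻ Z in {Z : Literature.MathematicalPhysics.QuantumManyBody.BoseGas.Config (n + 1) × Literature.MathematicalPhysics.QuantumManyBody.BoseGas.Config (n + 1) | Φ (Function.update Z.1 0 (Z.2 0)) ^ 2 * Φ (Function.update Z.2 0 (Z.1 0)) ^ 2 ≠ 0}, ENNReal.ofReal (Φ Z.1 ^ 2 * Φ Z.2 ^ 2 * (Real.log (Φ Z.1 ^ 2 * Φ Z.2 ^ 2) - Real.log (Φ (Function.update Z.1 0 (Z.2 0)) ^ 2 * Φ (Function.update Z.2 0 (Z.1 0)) ^ 2)))) ≤ 2 * ∫⁻ Z in {Z : Literature.MathematicalPhysics.QuantumManyBody.BoseGas.Config (n + 1) × Literature.MathematicalPhysics.QuantumManyBody.BoseGas.Config (n + 1) | Φ (Function.update Z.1 0 (Z.2 0)) ≠ 0}, ENNReal.ofReal (Φ Z.1 ^ 2 * Φ Z.2 ^ 2 * (Real.log (Φ Z.1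 ^ 2) - Real.log (Φ (Function.update Z.1 0 (Z.2 0)) ^ 2))) := by
  sorry

/-- stub T2 — BOX-AVERAGE SPLIT (general measurable real `Φ`, any reference volume `κ : ℝ`, exact, size M).
With `c(X) = log((∫ Φ(X[0↦z])² dz)/κ)` (a function of `X̂` only; whatever junk value `Real.log`/`toReal` return it is
a real number) the one-copy log-ratio splits POINTWISE as
`log Φ(X)² − log Φ(X[0↦y₀])² = [log Φ(X)² − c(X)] + [c(X) − log Φ(X[0↦y₀])²]`, hence, multiplying by `w = Φ(X)²Φ(Y)² ≥ 0`,
`ofReal (w(a+b)) ≤ ofReal (wa) + ofReal (wb)` (`ENNReal.ofReal_add_le`), the restricted lower integral is additive for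
the measurable first summand (`lintegral_add_left`; `c ∘ Prod.fst` is measurable by `Measurable.lintegral_prod_right'`)
and the CONCENTRATION term is only enlarged by dropping the restriction (`Measure.restrict_le_self`):
one-copy accessible entropy ≤ T_conc + T_hole. No normalisation, positivity or integrability of `Φ` is used. -/
theorem stub_boxAverageSplit :
    ∀ (n : ℕ) (Φ : Literature.MathematicalPhysics.QuantumManyBody.BoseGas.Config (n + 1) → ℝ) (κ : ℝ), Measurable Φ → let c : Literature.MathematicalPhysics.QuantumManyBody.BoseGas.Config (n + 1) → ℝ := fun X => Real.log ((∫⁻ z, ENNReal.ofReal (Φ (Function.update X 0 z) ^ 2)).toReal / κ); let w : Literature.MathematicalPhysics.QuantumManyBody.BoseGas.Config (n + 1) × Literature.MathematicalPhysics.QuantumManyBody.BoseGas.Config (n + 1) → ℝ := fun Z => Φ Z.1 ^ 2 * Φ Z.2 ^ 2; (∫⁻ Z in {Z : Literature.MathematicalPhysics.QuantumManyBody.BoseGas.Config (n + 1) × Literature.MathematicalPhysics.QuantumManyBody.BoseGas.Config (n + 1) | Φ (Function.update Z.1 0 (Z.2 0)) ≠ 0}, ENNReal.ofReal (w Z * (Real.log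 (Φ Z.1 ^ 2) - Real.log (Φ (Function.update Z.1 0 (Z.2 0)) ^ 2)))) ≤ (∫⁻ Z : Literature.MathematicalPhysics.QuantumManyBody.BoseGas.Config (n + 1) × Literature.MathematicalPhysics.QuantumManyBody.BoseGas.Config (n + 1), ENNReal.ofReal (w Z * (Real.log (Φ Z.1 ^ 2) - c Z.1))) + (∫⁻ Z in {Z : Literature.MathematicalPhysics.QuantumManyBody.BoseGas.Config (n + 1) × Literature.MathematicalPhysics.QuantumManyBody.BoseGas.Config (n + 1) | Φ (Function.update Z.1 0 (Z.2 0)) ≠ 0}, ENNReal.ofReal (w Z * (c Z.1 - Real.log (Φ (Function.update Z.1 0 (Z.2 0)) ^ 2)))) := by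
  sorry

/-- stub T3 — CONCENTRATION SIDE (mutual-information side; THE ground state; NO structural hypothesis; size XL but
SHARED territory). `T_conc = E_{X∼Ψ₀²}[(log Ψ₀²(X) − log(L⁻³∫Ψ₀²(z,X̂)dz))⁺] · ∫Ψ₀(Y)²dY = E_X̂ E_{x₀∼p_X̂}[(log L³p_X̂(x₀))⁺]`
(the second replica only supplies the factor `∫Ψ₀² = 1`; junk branch: everything is `0`). By `t (log t)⁻ ≤ e⁻¹`,
`T_conc ≤ E_X̂ KL(p_X̂ ‖ u_Λ) + e⁻¹ = I(x₀;X̂) + KL(n ‖ u_Λ) + e⁻¹`: bounded mutual information between one boson and the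
rest plus a bounded one-body profile entropy — the exact-ground-state case of `BECCellInformation.CondEntropyBound`
(stmt-13438; reduced there, by the PROVED `CoarseChainRule` 13441 + `TwoScaleReduction` 13443 — cube log-Sobolev paid in
kinetic energy `O((l/ξ)²)` — to `CellInformationBound` 13439 + `OneBodyEntropyBound` 13440), and implied by
`BECDeletionChiSquare.ChiSquareTolerance` (stmt-11937) through `KL ≤ log m₂`; either way plus the soft passage from
δ-near-minimisers to `groundState` (`IsGroundState.exists_tendstoL2`, L¹-convergence of `Ψ²`, lower semicontinuity of KL).
Why it might fail: log N growth of the coarse mutual information (Bragg/crystalline order of Ψ₀² at low density — not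
believed for d = 3 dilute repulsive bosons, but unproved) or a one-body pile-up; hard cores and walls are harmless here
(`p log p → 0`). Free case `a = 0`: sine product, `T_conc = KL(n‖u_Λ) + 0 = O(1)`. -/
theorem stub_concentrationSide :
    ∀ v : ℝ → ENNReal, Literature.MathematicalPhysics.QuantumManyBody.BoseGas.IsRepulsiveFiniteRange v → ∃ ρ₀ : ℝ, 0 < ρ₀ ∧ ∀ ρ : ℝ, 0 < ρ → ρ < ρ₀ → ∃ C : ℝ, ∀ᶠ n : ℕ in Filter.atTop, let Ψ₀ : Literature.MathematicalPhysics.QuantumManyBody.BoseGas.Config (n + 1) → ℝ := Literature.MathematicalPhysics.QuantumManyBody.BoseGas.groundState v (n + 1) (Literature.MathematicalPhysics.QuantumManyBody.BoseGas.sideLength ρ (n + 1)); let c : Literature.MathematicalPhysics.QuantumManyBody.BoseGas.Config (n + 1) → ℝ := fun X => Real.log ((∫⁻ z, ENNReal.ofReal (Ψ₀ (Function.update X 0 z) ^ 2)).toReal / Literature.MathematicalPhysics.QuantumManyBody.BoseGas.sideLength ρ (n + 1) ^ 3); (∫⁻ Z : Literature.MathematicalPhysics.QuantumManyBody.BoseGas.Config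 (n + 1) × Literature.MathematicalPhysics.QuantumManyBody.BoseGas.Config (n + 1), ENNReal.ofReal (Ψ₀ Z.1 ^ 2 * Ψ₀ Z.2 ^ 2 * (Real.log (Ψ₀ Z.1 ^ 2) - c Z.1))) ≤ ENNReal.ofReal C := by
  sorry

/-- stub T4 — HOLE SIDE (lautum / anti-concentration side; THE ground state; the crux's hypotheses H, L and the mass
hypothesis kept VERBATIM; size XL, the hardest stub, UNIQUE to this crux).
`T_hole = E_X̂ E_{y∼n}[(log(L⁻³∫Ψ₀²(z,X̂)dz) − log Ψ₀²(y,X̂))⁺ ; Ψ₀(y,X̂) ≠ 0] = E_X̂ E_{y∼n}[(−log L³p_X̂(y))⁺ ; acc]`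
(`x₀` integrates out against `p_X̂`, the second replica supplies only the law `n` of the insertion point `y = y₀`):
seen from an INDEPENDENT, accessible point the conditional density of the missing boson is not far below uniform in
log-mean — no deep holes except hard cores (excluded by accessibility) and healing layers (integrable log-singularities:
core contact `(1 − a/|y−x_j|)² ⇒` weight `≍ ρa³`; Dirichlet wall `Ψ₀² ∝ d²` against `n ∝ d²`, mass `O(ξ/L)`), plus the
infrared "vacancy seen from far away" term, which is where a crystalline Ψ₀ would fail (`−log p_X̂(y) ≍ log N` away from
the vacancy) and where ground-state minimality must enter (H alone cannot: it holds for phonon crystals). Intended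
engines: (i) Feynman–Kac LOWER Harnack for the insertion amplitude over ONE healing time `ξ² = (ρa)⁻¹` — an intruder
Brownian particle started at a uniform point survives/decouples at cost `O(1)` because the expected number of core
encounters in time `ξ²` is `≍ ρ·(2πa)·ξ² = O(1)` (Wiener sausage), which handles the tilt WITHOUT a pointwise Moser
estimate; (ii) for the infrared, the static-response/H₋₁ dictionary (`BECInsertionCorrector.StaticResponseBound`,
Kipnis–Varadhan) or birth's linear-response symbol against H. L is load-bearing at least to exclude super-singular soft
cores (`v = r^{-p}·1_{r≤R₀}`, `p ≥ 8`: `T_hole = +∞` at every `N ≥ 2`, and L(b) is false there — crux-attack evidence on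
stmt-12064), H possibly only as the window bookkeeping. Why it might fail: it is STRONGER than what BEC needs (no sibling
route needs the lautum side; `KL(n‖p_X̂) = +∞` for hard cores WITHOUT the accessibility restriction, so every estimate
must respect `{Ψ₀(y,X̂) ≠ 0}`), and the lost wall cancellation costs `O((ξ/L)log(L/ξ))` which must indeed → 0. -/
theorem stub_holeSide :
    ∀ v : ℝ → ENNReal, Literature.MathematicalPhysics.QuantumManyBody.BoseGas.IsRepulsiveFiniteRange v → ∃ ρ₀ : ℝ, 0 < ρ₀ ∧ ∀ ρ : ℝ, 0 < ρ → ρ < ρ₀ → ∀ C_H C_L : ℝ, ∃ C : ℝ, ∀ᶠ n : ℕ in Filter.atTop, (∀ m : Fin 3 → ℤ, m ≠ 0 → let L : ℝ := Literature.MathematicalPhysics.QuantumManyBody.BoseGas.sideLength ρ (n + 1); let a : ℝ := (Literature.MathematicalPhysics.QuantumManyBody.BoseGas.scatteringLength v).toReal; let k : ℝ := 2 * Real.pi / L * ‖(WithLp.toLp 2 fun t => (m t : ℝ) : EuclideanSpace ℝ (Fin 3))‖; k ≤ Real.sqrt (ρ * a) → Literature.MathematicalPhysics.QuantumManyBody.BoseGas.structureFactorVar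 (n + 1) L (fun X => (Literature.MathematicalPhysics.QuantumManyBody.BoseGas.groundState v (n + 1) L X : ℂ)) m ≤ ENNReal.ofReal (C_H * (n + 1) * k / Real.sqrt (ρ * a))) → (let L : ℝ := Literature.MathematicalPhysics.QuantumManyBody.BoseGas.sideLength ρ (n + 1); let Ψ₀ : Literature.MathematicalPhysics.QuantumManyBody.BoseGas.Config (n + 1) → ℝ := Literature.MathematicalPhysics.QuantumManyBody.BoseGas.groundState v (n + 1) L; let r : ℝ := (Real.sqrt (ρ * (Literature.MathematicalPhysics.QuantumManyBody.BoseGas.scatteringLength v).toReal))⁻¹; let B : Set Literature.MathematicalPhysics.QuantumManyBody.BoseGas.Space := Metric.ball 0 r; let Φ : Literature.MathematicalPhysics.QuantumManyBody.BoseGas.Config (n + 1) × Literature.MathematicalPhysics.QuantumManyBody.BoseGas.Space → ℝ := fun W => Ψ₀ (Function.update W.1 0 (W.1 0 + W.2)); (∫⁻ W in {W | W.2 ∈ B ∧ Φ W = 0}, ENNReal.ofReal (Ψ₀ W.1 ^ 2)) ≤ 4⁻¹ * MeasureTheory.volume B ∧ (∫⁻ W in {W | W.2 ∈ B ∧ Φ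 W ≠ 0}, ENNReal.ofReal (|Real.log (Ψ₀ W.1 ^ 2) - Real.log (Φ W ^ 2)| * Ψ₀ W.1 ^ 2)) ≤ ENNReal.ofReal C_L * MeasureTheory.volume B) → (let Ψ₀ : Literature.MathematicalPhysics.QuantumManyBody.BoseGas.Config (n + 1) → ℝ := Literature.MathematicalPhysics.QuantumManyBody.BoseGas.groundState v (n + 1) (Literature.MathematicalPhysics.QuantumManyBody.BoseGas.sideLength ρ (n + 1)); let p : Literature.MathematicalPhysics.QuantumManyBody.BoseGas.Config (n + 1) × Literature.MathematicalPhysics.QuantumManyBody.BoseGas.Config (n + 1) → ℝ := fun Z => Ψ₀ Z.1 ^ 2 * Ψ₀ Z.2 ^ 2; let q : Literature.MathematicalPhysics.QuantumManyBody.BoseGas.Config (n + 1) × Literature.MathematicalPhysics.QuantumManyBody.BoseGas.Config (n + 1) → ℝ := fun Z => Ψ₀ (Function.update Z.1 0 (Z.2 0)) ^ 2 * Ψ₀ (Function.update Z.2 0 (Z.1 0)) ^ 2; let c : Literature.MathematicalPhysics.QuantumManyBody.BoseGas.Config (n + 1) → ℝ := fun X => Real.log ((∫⁻ z, ENNReal.ofReal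 (Ψ₀ (Function.update X 0 z) ^ 2)).toReal / Literature.MathematicalPhysics.QuantumManyBody.BoseGas.sideLength ρ (n + 1) ^ 3); (1 / 2 : ENNReal) ≤ (∫⁻ Z in {Z | q Z ≠ 0}, ENNReal.ofReal (p Z)) → (∫⁻ Z in {Z : Literature.MathematicalPhysics.QuantumManyBody.BoseGas.Config (n + 1) × Literature.MathematicalPhysics.QuantumManyBody.BoseGas.Config (n + 1) | Ψ₀ (Function.update Z.1 0 (Z.2 0)) ≠ 0}, ENNReal.ofReal (p Z * (c Z.1 - Real.log (Ψ₀ (Function.update Z.1 0 (Z.2 0)) ^ 2)))) ≤ ENNReal.ofReal C) := by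
  sorry

/-- `2·(a⁺ + b⁺)` bookkeeping in `ℝ≥0∞` for the composition. -/
theorem two_mul_ofReal_add_two {a b : ℝ} (ha : 0 ≤ a) (hb : 0 ≤ b) :
    (2 : ENNReal) * (ENNReal.ofReal a + ENNReal.ofReal b) = ENNReal.ofReal (2 * (a + b)) := by
  rw [← ENNReal.ofReal_add ha hb, ENNReal.ofReal_mul (by norm_num : (0 : ℝ) ≤ 2), ENNReal.ofReal_ofNat]

/-- THE COMPOSITION (kernel-checked; its only `sorry`s are the four registered stubs, used BY NAME):
`ρ₀ = min ρ₃ ρ₄`, `C = 2 (C₃⁺ + C₄⁺)`, intersect the two eventual sets, then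
swap entropy ≤ 2·(one-copy) (T1 at `Φ := Ψ₀`) ≤ 2 (T_conc + T_hole) (T2 at `κ := L³`) ≤ ofReal C (T3, T4).
Concludes the crux `EntropyFromStructure` BY NAME. -/
theorem EntropyFromStructure_of : EntropyFromStructure := by
  intro v hv
  obtain ⟨ρ₃, hρ₃, H3⟩ := stub_concentrationSide v hv
  obtain ⟨ρ₄, hρ₄, H4⟩ := stub_holeSide v hv
  refine ⟨min ρ₃ ρ₄, lt_min hρ₃ hρ₄, fun ρ hρ hρlt C_H C_L => ?_⟩
  have hρ₃' : ρ < ρ₃ := lt_of_lt_of_le hρlt (min_le_left _ _)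
  have hρ₄' : ρ < ρ₄ := lt_of_lt_of_le hρlt (min_le_right _ _)
  obtain ⟨C₃, E3⟩ := H3 ρ hρ hρ₃'
  obtain ⟨C₄, E4⟩ := H4 ρ hρ hρ₄' C_H C_L
  refine ⟨2 * (max C₃ 0 + max C₄ 0), ?_⟩
  filter_upwards [E3, E4] with n e3 e4 hH hL Ψ₀ p q hmass
  have hmeas := Literature.MathematicalPhysics.QuantumManyBody.BoseGas.measurable_groundState v (n + 1)
    (Literature.MathematicalPhysics.QuantumManyBody.BoseGas.sideLength ρ (n + 1))
  have i1 := stub_oneCopyReduction n Ψ₀ hmeas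
  have i2 := stub_boxAverageSplit n Ψ₀
    (Literature.MathematicalPhysics.QuantumManyBody.BoseGas.sideLength ρ (n + 1) ^ 3) hmeas
  have i3 := e3
  have i4 := e4 hH hL hmass
  refine le_trans i1 ?_
  refine le_trans (mul_le_mul_right i2 2) ?_
  refine le_trans (mul_le_mul_right (add_le_add
    (le_trans i3 (ENNReal.ofReal_le_ofReal (le_max_left C₃ 0)))
    (le_trans i4 (ENNReal.ofReal_le_ofReal (le_max_left C₄ 0)))) 2) ?_
  exact (two_mul_ofReal_add_two (le_max_right C₃ 0) (le_max_right C₄ 0)).le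

end Summit.AtomisticToContinuum.BoseEinsteinCondensation.Cruxes.EntropyFromStructure.TwoSided
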